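import Literature.NumberTheory.Transcendental.KZProductIdeal
import Literature.NumberTheory.Transcendental.SemialgebraicMapsProofs
import Literature.NumberTheory.Transcendental.KZBallPeelingAux

/-!
# The rational Cauchy–disc chart `(x, s) ↦ (s(1−x²)/(1+x²), 2sx/(1+x²))`

Helper for the one-bijection normal form (`stub_tameForm`) of line `divisor-slicing-transshipment`
of crux `BetaCancellation` (stmt-KontsevichZagierPeriods-13633): the catalytic absorption of a
spectator goes through the unit disc, and the disc is the Cauchy line times a radial interval by a
RATIONAL rule-(2) chart. With `θ = 2·arctan x` (so `cos θ = (1−x²)/(1+x²)`, `sin θ = 2x/(1+x²)`,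
`dθ = 2dx/(1+x²)`) and radius `s`, the map
`Φ(x, s) = (s(1−x²)/(1+x²), 2sx/(1+x²))` sends `ℝ × (0,1)` injectively onto the open unit disc
minus the closed ray `{Y = 0, X ≤ 0}`, with Jacobian determinant `−2s/(1+x²)`:
`dX dY = (2s ds) · dx/(1+x²)`, i.e. `[D, 1] ∼ [ℝ × (0,1), 2s/(1+x²)] = [ℝ, 1/(1+x²)] × [(0,1), 2s]`.
Everything is a polynomial identity; no square root enters the map (only the inverse, in proofs).
-/

noncomputable section

set_option linter.dupNamespace false

open MeasureTheory Set Function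
open scoped Topology
open Literature.NumberTheory.Transcendental
open Literature.NumberTheory.Transcendental.KZ
open Literature.ModelTheory.ExponentialFields (IsSemialgebraic isSemialgebraic_univ)
open MvPolynomial (aeval X C)

namespace Summit.KontsevichZagierPeriods.KontsevichZagierPeriods.BetaCancellationDivisorSlicing

/-- The source half-strip `ℝ × (0,1)` of the Cauchy–disc chart is `ℚ`-semialgebraic. [folklore] -/
theorem isSemialgebraic_cauchyStrip :
    IsSemialgebraic ℚ {z : Fin 2 → ℝ | z 1 ∈ Set.Ioo (0:ℝ) 1} := by
  have h1 := Literature.ModelTheory.ExponentialFields.isSemialgebraic_setOf_eval_lt (k := ℚ) (R := ℝ)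
    (C 0 : MvPolynomial (Fin 2) ℚ) (X 1)
  have h2 := Literature.ModelTheory.ExponentialFields.isSemialgebraic_setOf_eval_lt (k := ℚ) (R := ℝ)
    (X 1 : MvPolynomial (Fin 2) ℚ) (C 1)
  have hset : {z : Fin 2 → ℝ | z 1 ∈ Set.Ioo (0:ℝ) 1} =
      {x | aeval x (C 0 : MvPolynomial (Fin 2) ℚ) < aeval x (X 1 : MvPolynomial (Fin 2) ℚ)} ∩
        {x | aeval x (X 1 : MvPolynomial (Fin 2) ℚ) < aeval x (C 1 : MvPolynomial (Fin 2) ℚ)} := by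
    ext x
    simp
  rw [hset]
  exact h1.inter h2

/-- The Cauchy–disc chart is a `ℚ`-semialgebraic map on the half-strip (its components are
quotients of rational polynomials with non-vanishing denominator `1 + x²`). [folklore] -/
theorem isSemialgebraicMapOn_cauchyDiscChart :
    IsSemialgebraicMapOn ℚ {z : Fin 2 → ℝ | z 1 ∈ Set.Ioo (0:ℝ) 1}
      (fun z : Fin 2 → ℝ =>
        (![z 1 * (1 - z 0 ^ 2) / (1 + z 0 ^ 2), z 1 * (2 * z 0) / (1 + z 0 ^ 2)] : Fin 2 → ℝ)) := by
  have hS := isSemialgebraic_cauchyStrip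
  have hden : ∀ z ∈ {z : Fin 2 → ℝ | z 1 ∈ Set.Ioo (0:ℝ) 1},
      aeval z (1 + X 0 ^ 2 : MvPolynomial (Fin 2) ℚ) ≠ 0 := by
    intro z _
    simp only [map_add, map_one, map_pow, MvPolynomial.aeval_X]
    positivity
  refine IsSemialgebraicMapOn.of_forall hS fun j => ?_
  fin_cases j
  · refine (isSemialgebraicFunOn_aeval_div_aeval hS (X 1 * (1 - X 0 ^ 2)) (1 + X 0 ^ 2) hden).congr
      fun z _ => ?_
    simp
  · refine (isSemialgebraicFunOn_aeval_div_aeval hS (X 1 * (2 * X 0)) (1 + X 0 ^ 2) hden).congr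
      fun z _ => ?_
    simp

/-- The Cauchy–disc chart is differentiable everywhere, with a derivative of determinant
`−2s/(1+x²)` (rows `∂(s·c(x))`, `∂(s·sn(x))` with `c = (1−x²)/(1+x²)`, `sn = 2x/(1+x²)`,
`c' = −2·sn/(1+x²)`, `sn' = 2·c/(1+x²)`, `c² + sn² = 1`). [folklore] -/
theorem hasFDerivAt_cauchyDiscChart (z : Fin 2 → ℝ) :
    ∃ L : (Fin 2 → ℝ) →L[ℝ] (Fin 2 → ℝ),
      HasFDerivAt (fun y : Fin 2 → ℝ =>
        (![y 1 * (1 - y 0 ^ 2) / (1 + y 0 ^ 2), y 1 * (2 * y 0) / (1 + y 0 ^ 2)] : Fin 2 → ℝ)) L z ∧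
      L.det = -(2 * z 1 / (1 + z 0 ^ 2)) := by
  set x : ℝ := z 0 with hx
  set s : ℝ := z 1 with hs
  have hq : (0:ℝ) < 1 + x ^ 2 := by positivity
  have hq' : (1:ℝ) + x ^ 2 ≠ 0 := hq.ne'
  -- entries of the Jacobian
  set a : ℝ := s * (-4 * x / (1 + x ^ 2) ^ 2) with ha        -- ∂/∂x of s·c(x)
  set b : ℝ := (1 - x ^ 2) / (1 + x ^ 2) with hb              -- ∂/∂s of s·c(x)
  set c : ℝ := s * (2 * (1 - x ^ 2) / (1 + x ^ 2) ^ 2) with hc -- ∂/∂x of s·sn(x)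
  set e : ℝ := 2 * x / (1 + x ^ 2) with he                    -- ∂/∂s of s·sn(x)
  set L : (Fin 2 → ℝ) →L[ℝ] (Fin 2 → ℝ) := LinearMap.toContinuousLinearMap
    (Matrix.toLin' (!![a, b; c, e] : Matrix (Fin 2) (Fin 2) ℝ)) with hL
  have hL0 : ∀ v, L v 0 = a * v 0 + b * v 1 := by
    intro v
    change Matrix.toLin' (!![a, b; c, e] : Matrix (Fin 2) (Fin 2) ℝ) v 0 = _
    rw [Matrix.toLin'_apply]
    simp [Matrix.mulVec, dotProduct, Fin.sum_univ_two]
  have hL1 : ∀ v, L v 1 = c * v 0 + e * v 1 := by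
    intro v
    change Matrix.toLin' (!![a, b; c, e] : Matrix (Fin 2) (Fin 2) ℝ) v 1 = _
    rw [Matrix.toLin'_apply]
    simp [Matrix.mulVec, dotProduct, Fin.sum_univ_two]
  -- derivatives of the building blocks `y ↦ y 0`, `y ↦ y 1`, `y ↦ c(y 0)`, `y ↦ sn(y 0)`
  have h0 : HasFDerivAt (fun y : Fin 2 → ℝ => y 0)
      (ContinuousLinearMap.proj (R := ℝ) (φ := fun _ : Fin 2 => ℝ) 0) z := hasFDerivAt_apply 0 z
  have h1 : HasFDerivAt (fun y : Fin 2 → ℝ => y 1)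
      (ContinuousLinearMap.proj (R := ℝ) (φ := fun _ : Fin 2 => ℝ) 1) z := hasFDerivAt_apply 1 z
  have hp := h0.pow 2
  have hn := hp.const_sub 1
  have hd := hp.const_add 1
  have hm := h0.const_mul (2:ℝ)
  have hinv := (hasDerivAt_inv hq').comp_hasFDerivAt z hd
  have hc0 := hn.mul hinv
  have hs0 := hm.mul hinv
  refine ⟨L, ?_, ?_⟩
  · rw [hasFDerivAt_pi']
    refine Fin.forall_fin_two.mpr ⟨?_, ?_⟩
    · have hf : (fun y : Fin 2 → ℝ =>
          (![y 1 * (1 - y 0 ^ 2) / (1 + y 0 ^ 2), y 1 * (2 * y 0) / (1 + y 0 ^ 2)] : Fin 2 → ℝ) 0) =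
          fun y => y 1 * ((1 - y 0 ^ 2) * ((fun t : ℝ => t⁻¹) ∘ fun y : Fin 2 → ℝ => 1 + y 0 ^ 2) y) := by
        funext y; simp [div_eq_mul_inv, mul_assoc]
      rw [hf]
      refine (h1.mul hc0).congr_fderiv (ContinuousLinearMap.ext fun v => ?_)
      rw [ContinuousLinearMap.comp_apply, ContinuousLinearMap.proj_apply, hL0]
      simp only [add_apply, smul_apply, neg_apply, ContinuousLinearMap.proj_apply,
        Function.comp_apply, Pi.mul_apply, smul_eq_mul, nsmul_eq_mul, Nat.cast_ofNat, pow_one,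
        Nat.add_one_sub_one, ha, hb, hs, hx]
      field_simp
      ring
    · have hf : (fun y : Fin 2 → ℝ =>
          (![y 1 * (1 - y 0 ^ 2) / (1 + y 0 ^ 2), y 1 * (2 * y 0) / (1 + y 0 ^ 2)] : Fin 2 → ℝ) 1) =
          fun y => y 1 * ((2 * y 0) * ((fun t : ℝ => t⁻¹) ∘ fun y : Fin 2 → ℝ => 1 + y 0 ^ 2) y) := by
        funext y; simp [div_eq_mul_inv, mul_assoc]
      rw [hf]
      refine (h1.mul hs0).congr_fderiv (ContinuousLinearMap.ext fun v => ?_)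
      rw [ContinuousLinearMap.comp_apply, ContinuousLinearMap.proj_apply, hL1]
      simp only [add_apply, smul_apply, ContinuousLinearMap.proj_apply,
        Function.comp_apply, Pi.mul_apply, smul_eq_mul, nsmul_eq_mul, Nat.cast_ofNat, pow_one,
        Nat.add_one_sub_one, hc, he, hs, hx]
      field_simp
      ring
  · change LinearMap.det (Matrix.toLin' (!![a, b; c, e] : Matrix (Fin 2) (Fin 2) ℝ)) = _
    rw [LinearMap.det_toLin', Matrix.det_fin_two]
    simp only [Matrix.of_apply, Matrix.cons_val', Matrix.cons_val_zero, Matrix.cons_val_one,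
      Matrix.cons_val_fin_one, ha, hb, hc, he]
    field_simp
    ring

/-- The squared norm of the chart point is `s²` (`c² + sn² = 1`). [folklore] -/
theorem cauchyDiscChart_normSq (x s : ℝ) :
    (s * (1 - x ^ 2) / (1 + x ^ 2)) ^ 2 + (s * (2 * x) / (1 + x ^ 2)) ^ 2 = s ^ 2 := by
  have hq : (1:ℝ) + x ^ 2 ≠ 0 := by positivity
  field_simp
  ring

/-- The Cauchy–disc chart is injective on the half-strip (the radius is `s`, then the angle: `x` is
recovered as `Y/(s + X)`). [folklore] -/
theorem injOn_cauchyDiscChart :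
    Set.InjOn (fun z : Fin 2 → ℝ =>
        (![z 1 * (1 - z 0 ^ 2) / (1 + z 0 ^ 2), z 1 * (2 * z 0) / (1 + z 0 ^ 2)] : Fin 2 → ℝ))
      {z : Fin 2 → ℝ | z 1 ∈ Set.Ioo (0:ℝ) 1} := by
  intro z hz w hw hzw
  have e0 := congrFun hzw 0
  have e1 := congrFun hzw 1
  simp only [Matrix.cons_val_zero, Matrix.cons_val_one] at e0 e1
  have hz1 : 0 < z 1 := hz.1
  have hw1 : 0 < w 1 := hw.1
  -- radii agree
  have hr : z 1 ^ 2 = w 1 ^ 2 := by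
    rw [← cauchyDiscChart_normSq (z 0) (z 1), ← cauchyDiscChart_normSq (w 0) (w 1), e0, e1]
  have h1 : z 1 = w 1 := by
    have := (sq_eq_sq₀ hz1.le hw1.le).1 hr
    exact this
  -- angles agree: `x = Y / (s + X)` with `s + X = 2s/(1+x²) > 0`
  have hqz : (0:ℝ) < 1 + z 0 ^ 2 := by positivity
  have hqw : (0:ℝ) < 1 + w 0 ^ 2 := by positivity
  have kz : z 1 + z 1 * (1 - z 0 ^ 2) / (1 + z 0 ^ 2) = 2 * z 1 / (1 + z 0 ^ 2) := by
    field_simp; ring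
  have kw : w 1 + w 1 * (1 - w 0 ^ 2) / (1 + w 0 ^ 2) = 2 * w 1 / (1 + w 0 ^ 2) := by
    field_simp; ring
  have xz : z 0 = (z 1 * (2 * z 0) / (1 + z 0 ^ 2)) / (z 1 + z 1 * (1 - z 0 ^ 2) / (1 + z 0 ^ 2)) := by
    rw [kz]; field_simp
  have xw : w 0 = (w 1 * (2 * w 0) / (1 + w 0 ^ 2)) / (w 1 + w 1 * (1 - w 0 ^ 2) / (1 + w 0 ^ 2)) := by
    rw [kw]; field_simp
  have h0 : z 0 = w 0 := by
    rw [xz, xw, e0, e1, h1]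
  funext i
  fin_cases i
  · exact h0
  · exact h1

/-- **The image of the Cauchy–disc chart** is the open unit disc minus the closed ray
`{Y = 0, X ≤ 0}` (inverse: `s = √(X²+Y²)`, `x = Y/(s+X)`). [folklore] -/
theorem image_cauchyDiscChart :
    (fun z : Fin 2 → ℝ =>
        (![z 1 * (1 - z 0 ^ 2) / (1 + z 0 ^ 2), z 1 * (2 * z 0) / (1 + z 0 ^ 2)] : Fin 2 → ℝ)) ''
        {z : Fin 2 → ℝ | z 1 ∈ Set.Ioo (0:ℝ) 1} =
      {w : Fin 2 → ℝ | w 0 ^ 2 + w 1 ^ 2 < 1 ∧ (w 1 ≠ 0 ∨ 0 < w 0)} := by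
  ext w
  constructor
  · rintro ⟨z, hz, rfl⟩
    have hz1 : 0 < z 1 := hz.1
    have hq : (0:ℝ) < 1 + z 0 ^ 2 := by positivity
    refine ⟨?_, ?_⟩
    · show (z 1 * (1 - z 0 ^ 2) / (1 + z 0 ^ 2)) ^ 2 + (z 1 * (2 * z 0) / (1 + z 0 ^ 2)) ^ 2 < 1
      rw [cauchyDiscChart_normSq]
      have : z 1 ^ 2 < 1 ^ 2 := by gcongr; exact hz.2
      simpa using this
    · show z 1 * (2 * z 0) / (1 + z 0 ^ 2) ≠ 0 ∨ 0 < z 1 * (1 - z 0 ^ 2) / (1 + z 0 ^ 2)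
      by_cases h : z 0 = 0
      · right
        rw [h]
        simp only [ne_eq, OfNat.ofNat_ne_zero, not_false_eq_true, zero_pow, sub_zero, mul_one,
          add_zero, div_one]
        exact hz1
      · left
        have : z 1 * (2 * z 0) ≠ 0 := mul_ne_zero hz1.ne' (mul_ne_zero two_ne_zero h)
        exact div_ne_zero this hq.ne'
  · rintro ⟨hw, hray⟩
    -- the radius and the half-angle tangent
    set ρ : ℝ := Real.sqrt (w 0 ^ 2 + w 1 ^ 2) with hρ
    have hnn : 0 ≤ w 0 ^ 2 + w 1 ^ 2 := by positivity
    have hρsq : ρ ^ 2 = w 0 ^ 2 + w 1 ^ 2 := Real.sq_sqrt hnn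
    have hρnn : 0 ≤ ρ := Real.sqrt_nonneg _
    have hρpos : 0 < ρ := by
      rcases hray with h | h
      · have : 0 < w 1 ^ 2 := by positivity
        exact Real.sqrt_pos.2 (by positivity)
      · exact Real.sqrt_pos.2 (by positivity)
    have hρ1 : ρ < 1 := by
      rw [hρ, Real.sqrt_lt' one_pos]; simpa using hw
    have habs : |w 0| ≤ ρ := by
      rw [← Real.sqrt_sq_eq_abs]
      exact Real.sqrt_le_sqrt (by nlinarith)
    have hden : 0 < ρ + w 0 := by
      rcases hray with h | h
      · -- `w 1 ≠ 0`: then `|w 0| < ρ`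
        have hlt : w 0 ^ 2 < ρ ^ 2 := by rw [hρsq]; nlinarith [sq_pos_of_ne_zero h]
        have : |w 0| < ρ := abs_lt_of_sq_lt_sq hlt hρnn
        linarith [neg_abs_le (w 0)]
      · linarith
    set t : ℝ := w 1 / (ρ + w 0) with ht
    refine ⟨![t, ρ], ⟨hρpos, hρ1⟩, ?_⟩
    -- `1 + t² = 2ρ/(ρ+X)`, `1 − t² = 2X/(ρ+X)`
    have hq : 1 + t ^ 2 = 2 * ρ / (ρ + w 0) := by
      rw [ht]; field_simp; nlinarith [hρsq]
    have hp : 1 - t ^ 2 = 2 * w 0 / (ρ + w 0) := by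
      rw [ht]; field_simp; nlinarith [hρsq]
    funext i
    fin_cases i
    · show ρ * (1 - t ^ 2) / (1 + t ^ 2) = w 0
      rw [hq, hp]; field_simp
    · show ρ * (2 * t) / (1 + t ^ 2) = w 1
      rw [hq, ht]; field_simp

/-- **Registered sub-goal `cauchyDiscChart`** (crux stmt-KontsevichZagierPeriods-13633, line
`divisor-slicing-transshipment`, helper for `stub_tameForm`): the rational chart
`(x, s) ↦ (s(1−x²)/(1+x²), 2sx/(1+x²))` is rule-(2) data from `ℝ × (0,1)` onto the slit open unit
disc with `|det| = 2s/(1+x²)`: `[D, F] ∼ [ℝ × (0,1), F∘Φ · 2s/(1+x²)]`, in particular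
`[D, 1] ∼ [ℝ, 1/(1+x²)] × [(0,1), 2s]`. [folklore] -/
theorem cauchyDiscChart : ∃ Φ' : (Fin 2 → ℝ) → (Fin 2 → ℝ) →L[ℝ] (Fin 2 → ℝ), IsSemialgebraic ℚ {z : Fin 2 → ℝ | z 1 ∈ Set.Ioo (0:ℝ) 1} ∧ IsSemialgebraicMapOn ℚ {z : Fin 2 → ℝ | z 1 ∈ Set.Ioo (0:ℝ) 1} (fun z : Fin 2 → ℝ => (![z 1 * (1 - z 0 ^ 2) / (1 + z 0 ^ 2), z 1 * (2 * z 0) / (1 + z 0 ^ 2)] : Fin 2 → ℝ)) ∧ Set.InjOn (fun z : Fin 2 → ℝ => (![z 1 * (1 - z 0 ^ 2) / (1 + z 0 ^ 2), z 1 * (2 * z 0) / (1 + z 0 ^ 2)] : Fin 2 → ℝ)) {z : Fin 2 → ℝ | z 1 ∈ Set.Ioo (0:ℝ) 1} ∧ (∀ z : Fin 2 → ℝ, HasFDerivAt (fun y : Fin 2 → ℝ => (![y 1 * (1 - y 0 ^ 2) / (1 + y 0 ^ 2), y 1 * (2 * y 0) / (1 + y 0 ^ 2)] : Fin 2 → ℝ))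 (Φ' z) z) ∧ (∀ z : Fin 2 → ℝ, (Φ' z).det = -(2 * z 1 / (1 + z 0 ^ 2))) ∧ (fun z : Fin 2 → ℝ => (![z 1 * (1 - z 0 ^ 2) / (1 + z 0 ^ 2), z 1 * (2 * z 0) / (1 + z 0 ^ 2)] : Fin 2 → ℝ)) '' {z : Fin 2 → ℝ | z 1 ∈ Set.Ioo (0:ℝ) 1} = {w : Fin 2 → ℝ | w 0 ^ 2 + w 1 ^ 2 < 1 ∧ (w 1 ≠ 0 ∨ 0 < w 0)} := by
  choose Φ' hΦ' hdet using hasFDerivAt_cauchyDiscChart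
  exact ⟨Φ', isSemialgebraic_cauchyStrip, isSemialgebraicMapOn_cauchyDiscChart, injOn_cauchyDiscChart,
    hΦ', hdet, image_cauchyDiscChart⟩

end Summit.KontsevichZagierPeriods.KontsevichZagierPeriods.BetaCancellationDivisorSlicing

end
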